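import Summits.BirchSwinnertonDyer.BirchSwinnertonDyer.Theorems.ManinLocalTwoThreeCurveExclusionFortyFour
import HarnessLib

/-!
# Level 45 (C3 domain, genus 3), part 5: the CURVE SIDE of the newform pinning — two column relations of `M₂(Γ₀(45))`, the
# prime-power recursions, the bits `2 ∤ N_W`, `5 ∣ N_W`, `a₃ = 0` and Hasse at `2` leave exactly `(a₂, a₅) ∈ {(1, −1), (−1, 1)}`

Cell `bsd-f2-manin`, route `ManinLocalTwoThree`, crux C3 `ManinPrimeToThreeAtNine` (stmt-BirchSwinnertonDyer-22968: `3² ∣ 45`), prover seat p2 gen 28;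
`--supports` (helper).  Pure integer arithmetic on the `L`-series coefficients `aₙ = W.LFunction n` of an elliptic curve `W/ℚ`, no modular
forms: IF `2 ∤ N_W` (so `a₄ = a₂² − 2`, `a₈ = a₂a₄ − 2a₂`, `a₁₆ = a₂a₈ − 2a₄`), `a₂₀ = a₄a₅` (multiplicativity), Hasse `|a₂| ≤ 2`, and the two
COLUMN RELATIONS of `M₂(Γ₀(45))` (`…BasisSolveFortyFive.columnRelations_fortyFive`) `a₁₆ = 3a₁ + 4a₄`, `a₂₀ = 5a₂ + 7a₅ − a₈` hold, THEN
`(a₂, a₅) = (1, −1)` (the newform `45a`) or `(a₂, a₅) = (−1, 1)` (the `3`-depleted old form `ι₁φ₁₅ + ⅓ι₃φ₁₅`); with `a₃ = 0` and `3 ∣ N_W`,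
`5 ∣ N_W` the whole pivot vector `(a₁, a₂, a₃, a₄, a₅, a₆, a₈, a₉, a₁₀, a₁₅)` follows (`pivotVector_fortyFive`).
Nothing here proves C3, Manin's conjecture or BSD. [cite: DiamondShurman2005, §8.8 (8.44)] [cite: SilvermanAEC2009, Thm. V.1.1]
-/

set_option autoImplicit false
-- lint-debt: the directory name repeats the summit name (sibling precedent `ManinLocalTwoThreeCurveExclusionFortyFour.lean`)
set_option linter.dupNamespace false

namespace Summit.BirchSwinnertonDyer.BirchSwinnertonDyer.Theorems.ManinLocalTwoThree.LevelFortyFive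

open Literature.NumberTheory.EllipticCurves LevelFortyFour

variable (W : WeierstrassCurve ℚ) [W.IsElliptic]

/-- `a₂₅ = a₅² − 𝟙(5)·5`. [cite: DiamondShurman2005, §8.8 (8.44)] -/
theorem lFunction_twentyFive : W.LFunction 25 = W.LFunction 5 * W.LFunction 5 -
    (if 5 ∣ W.conductorNorm ℤ then 0 else (5 : ℤ)) := by
  have h := W.LFunction_apply_prime_pow_add_two_of_prime (by norm_num : Nat.Prime 5) 0
  simp only [zero_add, pow_one, pow_zero, WeierstrassCurve.LFunction_apply_one, mul_one] at h
  norm_num at h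
  exact h

omit [W.IsElliptic] in
/-- `a₁₀ = a₂a₅`, `a₂₀ = a₄a₅`, `a₆ = a₂a₃`, `a₁₅ = a₃a₅` (multiplicativity at coprime arguments). [cite: DiamondShurman2005, §8.8 (8.44)] -/
theorem lFunction_products : W.LFunction 10 = W.LFunction 2 * W.LFunction 5 ∧ W.LFunction 20 = W.LFunction 4 * W.LFunction 5 ∧
    W.LFunction 6 = W.LFunction 2 * W.LFunction 3 ∧ W.LFunction 15 = W.LFunction 3 * W.LFunction 5 :=
  ⟨lFunction_mul W (show Nat.Coprime 2 5 by norm_num), lFunction_mul W (show Nat.Coprime 4 5 by norm_num),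
    lFunction_mul W (show Nat.Coprime 2 3 by norm_num), lFunction_mul W (show Nat.Coprime 3 5 by norm_num)⟩

/-- **The curve side of the level-45 exclusion.**  `2 ∤ N_W`, the column relations `a₁₆ = 3a₁ + 4a₄` and `a₂₀ = 5a₂ + 7a₅ − a₈`, the
`2`-power recursions, `a₂₀ = a₄a₅` and Hasse `|a₂| ≤ 2` force `(a₂, a₅) ∈ {(1, −1), (−1, 1)}`: from `a₁₆ = a₂⁴ − 6a₂² + 4 = 4a₂² − 5` one gets
`(a₂² − 1)(a₂² − 9) = 0`, Hasse kills `a₂ = ±3`, and then `(a₂² − 2)a₅ = 5a₂ + 7a₅ − a₂³ + 4a₂` gives `a₅ = −a₂`. [cite: DiamondShurman2005, §8.8 (8.44)] -/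
theorem curveSide_fortyFive (h2N : ¬ 2 ∣ W.conductorNorm ℤ)
    (h16 : W.LFunction 16 = 3 * W.LFunction 1 + 4 * W.LFunction 4)
    (h20 : W.LFunction 20 = 5 * W.LFunction 2 + 7 * W.LFunction 5 - W.LFunction 8) :
    (W.LFunction 2 = 1 ∧ W.LFunction 5 = -1) ∨ (W.LFunction 2 = -1 ∧ W.LFunction 5 = 1) := by
  have r4 := lFunction_four W
  have r8 := lFunction_eight W
  have r16 := lFunction_sixteen W
  simp only [h2N, if_false] at r4 r8 r16
  obtain ⟨-, r20, -, -⟩ := lFunction_products W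
  obtain ⟨⟨hH2l, hH2u⟩, -, -, -⟩ := hasse_bounds W
  rw [WeierstrassCurve.LFunction_apply_one] at h16
  rw [r16, r8, r4] at h16
  rw [r20, r4, r8] at h20
  generalize W.LFunction 2 = s at *
  generalize W.LFunction 5 = r at *
  interval_cases s
  · exfalso; nlinarith [h16]
  · right; exact ⟨rfl, by linarith [h20]⟩
  · exfalso; nlinarith [h16]
  · left; exact ⟨rfl, by linarith [h20]⟩
  · exfalso; nlinarith [h16]

/-- **The pivot vector.**  With `3 ∣ N_W`, `2 ∤ N_W`, `a₃ = 0` and the two column relations, the ten pivot coefficients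
`(a₁, a₂, a₃, a₄, a₅, a₆, a₈, a₉, a₁₀, a₁₅)` of the curve are `(1, 1, 0, −1, −1, 0, −3, 0, −1, 0)` (newform `45a`) or
`(1, −1, 0, −1, 1, 0, 3, 0, −1, 0)` (the old form `ι₁φ₁₅ + ⅓ι₃φ₁₅`). [cite: DiamondShurman2005, §8.8 (8.44)] -/
theorem pivotVector_fortyFive (h2N : ¬ 2 ∣ W.conductorNorm ℤ) (h3N : 3 ∣ W.conductorNorm ℤ) (ha3 : W.LFunction 3 = 0)
    (h16 : W.LFunction 16 = 3 * W.LFunction 1 + 4 * W.LFunction 4)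
    (h20 : W.LFunction 20 = 5 * W.LFunction 2 + 7 * W.LFunction 5 - W.LFunction 8) :
    (W.LFunction 1 = 1 ∧ W.LFunction 2 = 1 ∧ W.LFunction 3 = 0 ∧ W.LFunction 4 = -1 ∧ W.LFunction 5 = -1 ∧ W.LFunction 6 = 0 ∧
        W.LFunction 8 = -3 ∧ W.LFunction 9 = 0 ∧ W.LFunction 10 = -1 ∧ W.LFunction 15 = 0) ∨
      (W.LFunction 1 = 1 ∧ W.LFunction 2 = -1 ∧ W.LFunction 3 = 0 ∧ W.LFunction 4 = -1 ∧ W.LFunction 5 = 1 ∧ W.LFunction 6 = 0 ∧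
        W.LFunction 8 = 3 ∧ W.LFunction 9 = 0 ∧ W.LFunction 10 = -1 ∧ W.LFunction 15 = 0) := by
  have hcases := curveSide_fortyFive W h2N h16 h20
  have r4 := lFunction_four W
  have r8 := lFunction_eight W
  have r9 := lFunction_nine W
  simp only [h2N, if_false] at r4 r8
  simp only [h3N, if_true, sub_zero] at r9
  obtain ⟨r10, -, r6, r15⟩ := lFunction_products W
  rw [WeierstrassCurve.LFunction_apply_one]
  rcases hcases with ⟨h2, h5⟩ | ⟨h2, h5⟩
  · left
    rw [h2] at r4 r8 r10 r6; rw [h5] at r10 r15; rw [ha3] at r9 r6 r15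
    norm_num at r4; rw [r4] at r8; norm_num at r8 r9 r10 r6 r15
    exact ⟨rfl, h2, ha3, r4, h5, r6, r8, r9, r10, r15⟩
  · right
    rw [h2] at r4 r8 r10 r6; rw [h5] at r10 r15; rw [ha3] at r9 r6 r15
    norm_num at r4; rw [r4] at r8; norm_num at r8 r9 r10 r6 r15
    exact ⟨rfl, h2, ha3, r4, h5, r6, r8, r9, r10, r15⟩

end Summit.BirchSwinnertonDyer.BirchSwinnertonDyer.Theorems.ManinLocalTwoThree.LevelFortyFive
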